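import Summits.BirchSwinnertonDyer.BirchSwinnertonDyer.Theorems.SylvesterTwoHeegnerIndexCoupledTelescopeStep
import HarnessLib

/-!
# The COUPLED Cassels–Tate telescope, X-b: INTERLEAVING two lift families into hT^κ's odd/even lift
# conjuncts (companion of `…CoupledTelescopeLiftPackage`; pure index bookkeeping)

Crux `UpperOffV0HSYPlus` (stmt-BirchSwinnertonDyer-19804); census theorems p704180 / p704241 (display
hT^κ: `A`-lifts `sA i` at the ODD indices of `(0, K₀]`, `B`-lifts `sB i` at the EVEN ones, one exponent
function `N`, one room `κ`).  `…CoupledTelescopeLiftPackage.exists_lift_family` delivers, per curve, a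
family indexed by `0, …, m_X - 1` (zero beyond); this file re-indexes an `A`-family and a `B`-family (the
latter with the bottom class `x`) to the display's shape: `K₀ := 2·max(m_A, m_B)`,
`sA i := sA₁ ((i-1)/2)`, `sB i := sB₁ (i/2-1)`, `N i := if i % 2 = 1 then NA₁ ((i-1)/2) else NB₁ (i/2-1)`
(McCallum p. 288: `D^{-ε} = D₁ × D₃ × ⋯`, `D^{ε} = D₂ × D₄ × ⋯`; the odd-`p` tree's
`HeegnerPointsKolyvaginPrimaryOrderProofs` uses the same interleaving).

* `interleaved_lift_clauses` — the fifteen lift conjuncts of hT^κ (memberships, annihilation by parity,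
  exactness on `Finset.Ioc 0 K₀`, room, images in `D_X`, `𝒪`-independence over the parity filters with
  `x` on `B`, (gen) over the parity-filtered images) from the two families; abstract groups, theorem-only
  (no definition, no named fact); nothing asserted on 19804; no stub closed; BSD not claimed for any curve.
-/

-- every Summits module is named `Summit.<Summit>.<Problem>…`: the duplicated component is by design
set_option linter.dupNamespace false
set_option autoImplicit false

open scoped Classical

namespace Summit.BirchSwinnertonDyer.BirchSwinnertonDyer.Theorems.SylvesterTwoCoupledTelescope

section Interleave

variable {SA SB MA MB QA QB : Type*} [AddCommGroup SA] [AddCommGroup SB] [AddCommGroup MA]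
  [AddCommGroup MB] [AddCommGroup QA] [AddCommGroup QB]

/-- **Interleaving two lift families into hT^κ's lift conjuncts** (`A`-lifts at the ODD indices of
`(0, K₀]`, `B`-lifts at the EVEN ones, one exponent function `N`, `K₀ = 2·max(m_A, m_B)`): from the
outputs of `exists_lift_family` for `A` (no bottom class) and for `B` (with the bottom class `x`) and a
common room `κ`, the families `sA i := sA₁ ((i-1)/2)`, `sB i := sB₁ (i/2-1)`,
`N i := if i odd then NA₁ ((i-1)/2) else NB₁ (i/2-1)` satisfy the lift conjuncts of the displays
`hT₄^κ` / `hT₇^κ` (p704180 / p704241) BYTE-SHAPED: memberships, annihilation by parity, exactness on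
`Finset.Ioc 0 K₀`, room `N i ≤ κ`, `𝒪`-independence over the parity filters (with `x` on `B`), images in
`D_A`, `D_B`, the two (gen) clauses over the parity-filtered images (McCallum p. 288: `D^{-ε} = D₁ × D₃ ×
⋯`, `D^{ε} = D₂ × D₄ × ⋯`).  CONJUNCT MAP onto `Theorems/…CoupledTelescopeTailFourKappa.lean` (p704180,
48e6bece35faa434; the same lines in `…TailSevenKappa`, p704241): outputs 1–2 = the binders `hselA`/`hselB`
(l.109–111); 3–4 = `(∀ i, sA i ∈ AdmA) ∧ (∀ i, sB i ∈ AdmB)` (l.137); 5–6 = l.205 (annihilation by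
parity); 7–8 = l.206–207 (exactness on `Finset.Ioc 0 K₀`); 9 = l.208 (room `N i ≤ κ`); 10–11 = images
in `D_A`/`D_B` (feed the isotropy clauses l.209–212 through the rows' pull-back pairing; not a display
line); 12 = `hindA` l.213–215; 13 = `hindB` l.216–220; 14–15 = (gen) l.223–236 with `torsionH1ToH1 …`
as `τ_X` and `((d : Ш) : galH1)` as `ι_X d`. [cite: McCallumLMS1991, §5 Thm. 5.4 (proof, p. 288)] -/
theorem interleaved_lift_clauses (SelA : AddSubgroup SA) (SelB : AddSubgroup SB) (AdmA : Set SA)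
    (AdmB : Set SB) (wA : SA →+ SA) (wB : SB →+ SB) (τA : SA →+ QA) (τB : SB →+ QB)
    (ιA : MA →+ QA) (ιB : MB →+ QB) (wMA : MA →+ MA) (wMB : MB →+ MB) (DA : AddSubgroup MA)
    (DB : AddSubgroup MB) (x : SB) (κ : ℕ)
    -- the `A`-family
    (mA : ℕ) (sA₁ : ℕ → SA) (NA₁ : ℕ → ℕ) (hSelA₁ : ∀ i, sA₁ i ∈ SelA) (hAdmA₁ : ∀ i, sA₁ i ∈ AdmA)
    (hzeroA : ∀ i, mA ≤ i → sA₁ i = 0 ∧ NA₁ i = 0) (hNA₁ : ∀ i, ((2 : ℤ) ^ NA₁ i) • sA₁ i = 0)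
    (hexA : ∀ i < mA, NA₁ i ≠ 0 → ((2 : ℤ) ^ (NA₁ i - 1)) • sA₁ i ≠ 0) (hleA : ∀ i, NA₁ i ≤ κ)
    (himgA : ∀ i, ∃ a ∈ DA, τA (sA₁ i) = ιA a ∧ τA (wA (sA₁ i)) = ιA (wMA a))
    (hindA₁ : ∀ (I : Finset ℕ) (α β : ℕ → ℤ), ∑ i ∈ I, (α i • sA₁ i + β i • wA (sA₁ i)) = 0 →
      ∀ i ∈ I, α i • sA₁ i + β i • wA (sA₁ i) = 0)
    (hgenA₁ : ∀ d ∈ DA, ∃ g ∈ AddSubgroup.closure ((((Finset.range mA).image sA₁ : Finset SA) : Set SA) ∪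
      wA '' (((Finset.range mA).image sA₁ : Finset SA) : Set SA)), τA g = ιA d)
    -- the `B`-family (with the bottom class `x`)
    (mB : ℕ) (sB₁ : ℕ → SB) (NB₁ : ℕ → ℕ) (hSelB₁ : ∀ i, sB₁ i ∈ SelB) (hAdmB₁ : ∀ i, sB₁ i ∈ AdmB)
    (hzeroB : ∀ i, mB ≤ i → sB₁ i = 0 ∧ NB₁ i = 0) (hNB₁ : ∀ i, ((2 : ℤ) ^ NB₁ i) • sB₁ i = 0)
    (hexB : ∀ i < mB, NB₁ i ≠ 0 → ((2 : ℤ) ^ (NB₁ i - 1)) • sB₁ i ≠ 0) (hleB : ∀ i, NB₁ i ≤ κ)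
    (himgB : ∀ i, ∃ a ∈ DB, τB (sB₁ i) = ιB a ∧ τB (wB (sB₁ i)) = ιB (wMB a))
    (hindB₁ : ∀ (I : Finset ℕ) (b c : ℤ) (α β : ℕ → ℤ),
      (b • x + c • wB x) + ∑ i ∈ I, (α i • sB₁ i + β i • wB (sB₁ i)) = 0 →
        b • x + c • wB x = 0 ∧ ∀ i ∈ I, α i • sB₁ i + β i • wB (sB₁ i) = 0)
    (hgenB₁ : ∀ d ∈ DB, ∃ g ∈ AddSubgroup.closure ((((Finset.range mB).image sB₁ : Finset SB) : Set SB) ∪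
      wB '' (((Finset.range mB).image sB₁ : Finset SB) : Set SB)), τB g = ιB d) :
    ∃ (K₀ : ℕ) (sA : ℕ → SA) (sB : ℕ → SB) (N : ℕ → ℕ),
      (∀ i, sA i ∈ SelA) ∧ (∀ i, sB i ∈ SelB) ∧ (∀ i, sA i ∈ AdmA) ∧ (∀ i, sB i ∈ AdmB) ∧
      (∀ i, Odd i → ((2 : ℤ) ^ N i) • sA i = 0) ∧ (∀ i, Even i → ((2 : ℤ) ^ N i) • sB i = 0) ∧
      (∀ i ∈ Finset.Ioc 0 K₀, Odd i → N i ≠ 0 → ((2 : ℤ) ^ (N i - 1)) • sA i ≠ 0) ∧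
      (∀ i ∈ Finset.Ioc 0 K₀, Even i → N i ≠ 0 → ((2 : ℤ) ^ (N i - 1)) • sB i ≠ 0) ∧
      (∀ i ∈ Finset.Ioc 0 K₀, N i ≤ κ) ∧
      (∀ i, ∃ a ∈ DA, τA (sA i) = ιA a ∧ τA (wA (sA i)) = ιA (wMA a)) ∧
      (∀ i, ∃ a ∈ DB, τB (sB i) = ιB a ∧ τB (wB (sB i)) = ιB (wMB a)) ∧
      (∀ (α β : ℕ → ℤ),
        ∑ j ∈ (Finset.Ioc 0 K₀).filter (fun j ↦ Odd j), (α j • sA j + β j • wA (sA j)) = 0 →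
          ∀ j ∈ (Finset.Ioc 0 K₀).filter (fun j ↦ Odd j), α j • sA j + β j • wA (sA j) = 0) ∧
      (∀ (b c : ℤ) (α β : ℕ → ℤ),
        (b • x + c • wB x) +
            ∑ j ∈ (Finset.Ioc 0 K₀).filter (fun j ↦ Even j), (α j • sB j + β j • wB (sB j)) = 0 →
          b • x + c • wB x = 0 ∧
            ∀ j ∈ (Finset.Ioc 0 K₀).filter (fun j ↦ Even j), α j • sB j + β j • wB (sB j) = 0) ∧
      (∀ d ∈ DA, ∃ g ∈ AddSubgroup.closure
          (((((Finset.Ioc 0 K₀).filter (fun j ↦ Odd j)).image sA : Finset SA) : Set SA) ∪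
            wA '' ((((Finset.Ioc 0 K₀).filter (fun j ↦ Odd j)).image sA : Finset SA) : Set SA)),
        τA g = ιA d) ∧
      (∀ d ∈ DB, ∃ g ∈ AddSubgroup.closure
          (((((Finset.Ioc 0 K₀).filter (fun j ↦ Even j)).image sB : Finset SB) : Set SB) ∪
            wB '' ((((Finset.Ioc 0 K₀).filter (fun j ↦ Even j)).image sB : Finset SB) : Set SB)),
        τB g = ιB d) := by
  let m := max mA mB
  let sA : ℕ → SA := fun i ↦ sA₁ ((i - 1) / 2)
  let sB : ℕ → SB := fun i ↦ sB₁ (i / 2 - 1)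
  let N : ℕ → ℕ := fun i ↦ if i % 2 = 1 then NA₁ ((i - 1) / 2) else NB₁ (i / 2 - 1)
  have hN_odd : ∀ i, Odd i → N i = NA₁ ((i - 1) / 2) := fun i hi ↦ if_pos (Nat.odd_iff.mp hi)
  have hN_even : ∀ i, Even i → N i = NB₁ (i / 2 - 1) := fun i hi ↦
    if_neg (by rw [Nat.even_iff.mp hi]; exact Nat.zero_ne_one)
  -- contrapositives of the vanishing beyond `m_X`
  have hltA : ∀ j, NA₁ j ≠ 0 → j < mA := fun j hj ↦ by
    by_contra h; exact hj (hzeroA j (not_lt.mp h)).2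
  have hltB : ∀ j, NB₁ j ≠ 0 → j < mB := fun j hj ↦ by
    by_contra h; exact hj (hzeroB j (not_lt.mp h)).2
  -- the index maps `j ↦ (j-1)/2` (odd `j`) and `j ↦ j/2-1` (even `j > 0`) are injective
  have hinjA : ∀ j ∈ (Finset.Ioc 0 (2 * m)).filter (fun j ↦ Odd j),
      ∀ j' ∈ (Finset.Ioc 0 (2 * m)).filter (fun j ↦ Odd j), (j - 1) / 2 = (j' - 1) / 2 → j = j' := by
    intro j hj j' hj' h
    have ho := Nat.odd_iff.mp (Finset.mem_filter.mp hj).2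
    have ho' := Nat.odd_iff.mp (Finset.mem_filter.mp hj').2
    omega
  have hinjB : ∀ j ∈ (Finset.Ioc 0 (2 * m)).filter (fun j ↦ Even j),
      ∀ j' ∈ (Finset.Ioc 0 (2 * m)).filter (fun j ↦ Even j), j / 2 - 1 = j' / 2 - 1 → j = j' := by
    intro j hj j' hj' h
    have hm := Finset.mem_filter.mp hj
    have hm' := Finset.mem_filter.mp hj'
    have he := Nat.even_iff.mp hm.2
    have he' := Nat.even_iff.mp hm'.2
    have h0 := (Finset.mem_Ioc.mp hm.1).1
    have h0' := (Finset.mem_Ioc.mp hm'.1).1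
    omega
  -- the basis indices sit inside the parity filters
  have hsubA : (((Finset.range mA).image sA₁ : Finset SA) : Set SA) ⊆
      ((((Finset.Ioc 0 (2 * m)).filter (fun j ↦ Odd j)).image sA : Finset SA) : Set SA) := by
    intro v hv
    rw [Finset.coe_image, Set.mem_image] at hv ⊢
    obtain ⟨i, hi, rfl⟩ := hv
    have him : i < mA := Finset.mem_range.mp (Finset.mem_coe.mp hi)
    refine ⟨2 * i + 1, Finset.mem_coe.mpr (Finset.mem_filter.mpr ⟨Finset.mem_Ioc.mpr ⟨by omega, ?_⟩,
      Nat.odd_iff.mpr (by omega)⟩), ?_⟩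
    · have : mA ≤ m := le_max_left _ _
      omega
    · show sA₁ ((2 * i + 1 - 1) / 2) = sA₁ i
      congr 1; omega
  have hsubB : (((Finset.range mB).image sB₁ : Finset SB) : Set SB) ⊆
      ((((Finset.Ioc 0 (2 * m)).filter (fun j ↦ Even j)).image sB : Finset SB) : Set SB) := by
    intro v hv
    rw [Finset.coe_image, Set.mem_image] at hv ⊢
    obtain ⟨i, hi, rfl⟩ := hv
    have him : i < mB := Finset.mem_range.mp (Finset.mem_coe.mp hi)
    refine ⟨2 * i + 2, Finset.mem_coe.mpr (Finset.mem_filter.mpr ⟨Finset.mem_Ioc.mpr ⟨by omega, ?_⟩,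
      Nat.even_iff.mpr (by omega)⟩), ?_⟩
    · have : mB ≤ m := le_max_right _ _
      omega
    · show sB₁ ((2 * i + 2) / 2 - 1) = sB₁ i
      congr 1; omega
  have hmonoA := AddSubgroup.closure_mono (Set.union_subset_union hsubA (Set.image_mono (f := ⇑wA) hsubA))
  have hmonoB := AddSubgroup.closure_mono (Set.union_subset_union hsubB (Set.image_mono (f := ⇑wB) hsubB))
  refine ⟨2 * m, sA, sB, N, fun i ↦ hSelA₁ _, fun i ↦ hSelB₁ _, fun i ↦ hAdmA₁ _, fun i ↦ hAdmB₁ _,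
    fun i hi ↦ by rw [hN_odd i hi]; exact hNA₁ _, fun i hi ↦ by rw [hN_even i hi]; exact hNB₁ _,
    fun i _ hi hNi ↦ ?_, fun i _ hi hNi ↦ ?_, fun i _ ↦ ?_, fun i ↦ himgA _, fun i ↦ himgB _,
    fun α β h ↦ ?_, fun b c α β h ↦ ?_,
    fun d hd ↦ ?_, fun d hd ↦ ?_⟩
  · rw [hN_odd i hi] at hNi ⊢
    exact hexA _ (hltA _ hNi) hNi
  · rw [hN_even i hi] at hNi ⊢
    exact hexB _ (hltB _ hNi) hNi
  · show (if i % 2 = 1 then NA₁ ((i - 1) / 2) else NB₁ (i / 2 - 1)) ≤ κ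
    split_ifs
    exacts [hleA _, hleB _]
  · -- `𝒪`-independence of the `A`-lifts over the odd indices: re-index by `j ↦ (j-1)/2`
    have hre : ∑ i ∈ ((Finset.Ioc 0 (2 * m)).filter (fun j ↦ Odd j)).image (fun j ↦ (j - 1) / 2),
        ((α (2 * i + 1)) • sA₁ i + (β (2 * i + 1)) • wA (sA₁ i)) =
        ∑ j ∈ (Finset.Ioc 0 (2 * m)).filter (fun j ↦ Odd j), (α j • sA j + β j • wA (sA j)) := by
      rw [Finset.sum_image hinjA]
      refine Finset.sum_congr rfl fun j hj ↦ ?_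
      have ho := Nat.odd_iff.mp (Finset.mem_filter.mp hj).2
      have hj' : 2 * ((j - 1) / 2) + 1 = j := by omega
      rw [hj']
    have h0 := hindA₁ _ (fun i ↦ α (2 * i + 1)) (fun i ↦ β (2 * i + 1)) (hre.trans h)
    intro j hj
    have ho := Nat.odd_iff.mp (Finset.mem_filter.mp hj).2
    have := h0 ((j - 1) / 2) (Finset.mem_image_of_mem _ hj)
    have hj' : 2 * ((j - 1) / 2) + 1 = j := by omega
    rwa [hj'] at this
  · -- the same on `B`, with the bottom class `x`, over the even indices: re-index by `j ↦ j/2-1`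
    have hre : ∑ i ∈ ((Finset.Ioc 0 (2 * m)).filter (fun j ↦ Even j)).image (fun j ↦ j / 2 - 1),
        ((α (2 * i + 2)) • sB₁ i + (β (2 * i + 2)) • wB (sB₁ i)) =
        ∑ j ∈ (Finset.Ioc 0 (2 * m)).filter (fun j ↦ Even j), (α j • sB j + β j • wB (sB j)) := by
      rw [Finset.sum_image hinjB]
      refine Finset.sum_congr rfl fun j hj ↦ ?_
      have hm := Finset.mem_filter.mp hj
      have he := Nat.even_iff.mp hm.2
      have h0 := (Finset.mem_Ioc.mp hm.1).1
      have hj' : 2 * (j / 2 - 1) + 2 = j := by omega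
      rw [hj']
    have h0 := hindB₁ _ b c (fun i ↦ α (2 * i + 2)) (fun i ↦ β (2 * i + 2)) (by rw [hre]; exact h)
    refine ⟨h0.1, fun j hj ↦ ?_⟩
    have hm := Finset.mem_filter.mp hj
    have he := Nat.even_iff.mp hm.2
    have h0j := (Finset.mem_Ioc.mp hm.1).1
    have := h0.2 (j / 2 - 1) (Finset.mem_image_of_mem _ hj)
    have hj' : 2 * (j / 2 - 1) + 2 = j := by omega
    rwa [hj'] at this
  · obtain ⟨g, hg, hτg⟩ := hgenA₁ d hd
    exact ⟨g, hmonoA hg, hτg⟩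
  · obtain ⟨g, hg, hτg⟩ := hgenB₁ d hd
    exact ⟨g, hmonoB hg, hτg⟩

end Interleave

end Summit.BirchSwinnertonDyer.BirchSwinnertonDyer.Theorems.SylvesterTwoCoupledTelescope
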